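/-
Copyright: cell pub-balaban-gaps (YM BLITZ Y1, track G1), seat g1-p2 GEN 6 (unit `pub-balaban-gaps-g1-p2`).  Row (D4) NODE O,
CURRENCY JUNCTION: planner g1-plan-1 GEN 16's skeleton #16 (`pub-balaban-gaps-g1-plan-1/skel16_L2_to_rowmass_currency.NOT-TO-FILE.lean`,
sha16 5d6987c5fde8020c; lens L-16 (β)) PORTED VERBATIM WITH CREDIT into the tree — statements and proofs are the planner's; this seat
only files.  HONEST FRAMING: [folklore] linear algebra on ONE finite lattice (Cauchy–Schwarz); no Bałaban operator is instantiated; the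
(α) packaging (local inverses as a `DomainTerms` family), the `SiteL2K`-to-matrix packaging and the (γ) real→complex conversion of L-16
are NOT here; (D4) NOT discharged (instance 0∕1); NOT BetaPertH, NOT continuum, NOT Clay.
-/
import Mathlib.Analysis.CStarAlgebra.Matrix
import Literature.MathematicalPhysics.QuantumLattice.FermionDeterminantBound
import Summits.QuantumFields.BalabanUV.Gaps.D4WalkBlock

/-!
# `Gaps.D4WalkBlockL2Currency` — the ℓ²-block-operator norm → row-mass `blockNorm` conversion costs exactly `√N_□`
# (cell pub-balaban-gaps, seat g1-p2 GEN 6; mathematics g1-plan-1 GEN 16, skeleton #16)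

HONEST DEPENDENCY (cell pub-balaban, verbatim): continuum YM on T⁴ ⇐ BetaPertH ∧ nine spine estimates (0/9 proved);
BetaPertH ⇐ (D1) ∧ (D4) ∧ CAP+tail.

WHY.  The (F)-half letters of the (D4) road (45's `hLbdD`, 46's `hmajD`, 47's block letters, 49–52's tail letter) are written in 33's
ROW-MASS block currency `blockNorm` (ℓ^∞ → ℓ^∞ between cubes; print's (3.108) currency).  The pub-balaban NE9 chain proves, for
Bałaban's ACTUAL one-level operator `Δ′_{a′}(U) = D_U*D_U + a′Q̃′(U)*Q̃′(U)` ((3.24)–(3.25) p. 394) at real small-field `U`, block decay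
of `G′(U)` in the ℓ²-BLOCK-OPERATOR currency (`Literature/…/B9Eq349ConjugatedGreenBlockDecay.exists_block_decay_Gp`, p363301 ✓:
`‖P_{y₁} ∘ G′(U) ∘ P_{y₀}‖ ≤ C·e^r·e^{−r·d_m(y₀,y₁)}`).  Planner g1-plan-1 GEN 16's lens L-16 located the three conversions between
the two (α packaging, β currency, γ real→complex) and typed (β) as skeleton #16; THIS FILE is that skeleton, filed: the conversion
costs EXACTLY `√N_□`, `N_□` = fine sites per column cube — `L^d` at one level, `(L^k)^d` at `k` levels (why (β) is a ONE-LEVEL road and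
why print's Sect. C sup ∕ Hölder machinery, resp. the Cor-3.6 chain, is the k-uniform one — L-14 made quantitative).
* §1 `row_sum_norm_le_sqrt_card_mul` (`Σ_j ‖A i j‖ ≤ √(card n)·‖A‖₂→₂`; the row bound `Σ_j ‖A i j‖² ≤ ‖A‖₂→₂²` is the tree's
  `Literature.MathematicalPhysics.QuantumLattice.sum_sq_norm_row_le_sq_norm`, reused BY NAME);
* §2 `blk` (the `(y,y′)` sub-block as a `submatrix`), `rowMass_le_sqrt_mul_l2norm_blk`, `blockNorm_le_sqrt_mul_l2norm_blk`,
  **`blockNorm_le_of_l2Block`** (`‖blk T y y′‖ ≤ Km y y′ ⟹ blockNorm ≤ √N·Km`), **`blockNorm_le_of_l2BlockDecay`** (the decay form: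
  `λ = √N·C`).
Value: kernel-checked bookkeeping; nothing of Bałaban's asserted; words of row (D4) UNCHANGED.

References: T. Bałaban, Comm. Math. Phys. 99 (1985) 389–434 [B9], (3.24)–(3.25) p.394, Thm 3.1 (3.42) p.397, (3.49) p.399, Thm 3.10
(3.108) p.416.
-/

noncomputable section

open scoped Matrix Matrix.Norms.L2Operator ComplexConjugate
open Finset
open Literature.MathematicalPhysics.QuantumFieldTheory.Balaban1983to89.B5TorusCover (UT)
open Summit.QuantumFields.BalabanUV.Gaps.D4WalkBlock
  (rowMass blockNorm rowMass_le_blockNorm blockNorm_le_of_rowMass_le blockNorm_nonneg)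
open Literature.MathematicalPhysics.QuantumLattice (sum_sq_norm_row_le_sq_norm)

namespace Summit.QuantumFields.BalabanUV.Gaps.D4WalkBlockL2Currency

/-! ## §1. Generic: a row's ℓ¹-mass is at most √(#columns) × the ℓ²-operator norm -/

section Generic

variable {m n : Type*} [Fintype m] [Fintype n] [DecidableEq m] [DecidableEq n]

/-- **Σ_j ‖A i j‖ ≤ √(card n) · ‖A‖₂→₂** — the geometry number of the currency conversion. [folklore: Cauchy–Schwarz] -/
theorem row_sum_norm_le_sqrt_card_mul (A : Matrix m n ℂ) (i : m) :
    ∑ j, ‖A i j‖ ≤ Real.sqrt (Fintype.card n) * ‖A‖ := by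
  have hcs := Finset.sum_mul_sq_le_sq_mul_sq (Finset.univ : Finset n) (fun _ => (1 : ℝ)) (fun j => ‖A i j‖)
  have hcs' : (∑ j, ‖A i j‖) ^ 2 ≤ (Fintype.card n : ℝ) * ∑ j, ‖A i j‖ ^ 2 := by simpa using hcs
  have h3 : (∑ j, ‖A i j‖) ^ 2 ≤ (Real.sqrt (Fintype.card n) * ‖A‖) ^ 2 := by
    rw [mul_pow, Real.sq_sqrt (Nat.cast_nonneg _)]
    exact hcs'.trans (mul_le_mul_of_nonneg_left (sum_sq_norm_row_le_sq_norm A i) (Nat.cast_nonneg _))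
  exact (pow_le_pow_iff_left₀ (Finset.sum_nonneg fun j _ => norm_nonneg _)
    (mul_nonneg (Real.sqrt_nonneg _) (norm_nonneg _)) two_ne_zero).mp h3

end Generic

/-! ## §2. The (y, y′) block of a site matrix and the conversion to 33's `blockNorm` -/

section Block

variable {ν : ℕ} {K : Fin ν → ℕ}
variable {p n : Type} [Fintype p] [Fintype n] [DecidableEq p] [DecidableEq n]
variable (cub : p → UT K) (cubn : n → UT K)

/-- The `(y, y′)` block of `T` as a matrix over the two site sub-types (no weight: a `submatrix`). [folklore] -/
abbrev blk (T : Matrix p n ℂ) (y y' : UT K) : Matrix {i // cub i = y} {j // cubn j = y'} ℂ :=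
  T.submatrix (fun i => i.1) (fun j => j.1)

/-- A row mass inside the column cube `y′` is at most `√N_{y′}` × the ℓ²-operator norm of the `(y, y′)` block. [folklore] -/
theorem rowMass_le_sqrt_mul_l2norm_blk (T : Matrix p n ℂ) (y y' : UT K) (i : p) (hi : cub i = y) :
    rowMass cubn T i y' ≤ Real.sqrt (Fintype.card {j // cubn j = y'}) * ‖blk cub cubn T y y'‖ := by
  have h := row_sum_norm_le_sqrt_card_mul (blk cub cubn T y y') ⟨i, hi⟩
  have hre : rowMass cubn T i y' = ∑ j : {j // cubn j = y'}, ‖blk cub cubn T y y' ⟨i, hi⟩ j‖ := by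
    unfold rowMass
    rw [Finset.sum_subtype (Finset.univ.filter fun j => cubn j = y') (p := fun j => cubn j = y')
      (fun j => by simp)]
    rfl
  rw [hre]
  exact h

/-- **33's block norm ≤ `√N_{y′}` × the ℓ²-operator norm of the block.** [folklore] -/
theorem blockNorm_le_sqrt_mul_l2norm_blk (T : Matrix p n ℂ) (y y' : UT K) :
    blockNorm cub cubn T y y' ≤ Real.sqrt (Fintype.card {j // cubn j = y'}) * ‖blk cub cubn T y y'‖ :=
  blockNorm_le_of_rowMass_le cub cubn T y y' (mul_nonneg (Real.sqrt_nonneg _) (norm_nonneg _))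
    fun i hi => rowMass_le_sqrt_mul_l2norm_blk cub cubn T y y' i hi

/-- **(β) of L-16, typed.** An ℓ²-BLOCK-OPERATOR letter `‖T_{(y,y′)}‖₂→₂ ≤ Km y y′` (the currency of the pub-balaban NE9 chain's
`B9Eq349ConjugatedGreenBlockDecay.exists_block_decay_Gp`, modulo the `SiteL2K`-to-matrix packaging) gives the row-mass block-norm
letter with the kernel `√N · Km`, `N` = the largest column-cube size — the geometry number that is `L^d` at one level and `(L^k)^d` at
`k` levels. [cite: Balaban1985BackgroundPropagators, (3.42) p.397, (3.49) p.399, (3.108) p.416] -/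
theorem blockNorm_le_of_l2Block (T : Matrix p n ℂ) (N : ℕ) (hN : ∀ y', Fintype.card {j // cubn j = y'} ≤ N)
    (Km : UT K → UT K → ℝ) (hL2 : ∀ y y', ‖blk cub cubn T y y'‖ ≤ Km y y') (y y' : UT K) :
    blockNorm cub cubn T y y' ≤ Real.sqrt N * Km y y' :=
  (blockNorm_le_sqrt_mul_l2norm_blk cub cubn T y y').trans
    (mul_le_mul (Real.sqrt_le_sqrt (by exact_mod_cast hN y')) (hL2 y y') (norm_nonneg _) (Real.sqrt_nonneg _))

/-- The decay instance: `‖T_{(y,y′)}‖₂→₂ ≤ C·e^{−κ·d(y,y′)}` ↦ `blockNorm T y y′ ≤ (√N·C)·e^{−κ·d(y,y′)}` — the shape of 45's `hLbdD`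
∕ 47's block letters with `λ = √N·C` (and, via 46's `blkMaj_of_blockNorm_le`, 46's `hmajD`); the tail letter of 49–52 likewise.
[cite: Balaban1985BackgroundPropagators, (3.42) p.397, (3.49) p.399, (3.108) p.416] -/
theorem blockNorm_le_of_l2BlockDecay (T : Matrix p n ℂ) (N : ℕ) (hN : ∀ y', Fintype.card {j // cubn j = y'} ≤ N)
    (d : UT K → UT K → ℝ) (C κ : ℝ)
    (hL2 : ∀ y y', ‖blk cub cubn T y y'‖ ≤ C * Real.exp (-(κ * d y y'))) (y y' : UT K) :
    blockNorm cub cubn T y y' ≤ (Real.sqrt N * C) * Real.exp (-(κ * d y y')) := by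
  rw [mul_assoc]
  exact blockNorm_le_of_l2Block cub cubn T N hN (fun y y' => C * Real.exp (-(κ * d y y'))) hL2 y y'

end Block

end Summit.QuantumFields.BalabanUV.Gaps.D4WalkBlockL2Currency

end
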